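import Summits.BirchSwinnertonDyer.Rank1Residual.X4.HeckeDerivativeFamily
import HarnessLib

/-!
# Test functions for lemma S: the periodic function supported on the points `x/D + ℤ`, `x ∈ (ℤ/D)ˣ`, with prescribed values (cell `b2b-bsdres`, seat additive-p4 gen 30, line V51′ — brick S2 of lemma S)

HONEST FRAMING (verbatim, cell `b2b-bsdres`): the goal of the cell is to DELETE the COMBINATION-SHAPED
residual classes for ALL analytic-rank `≤ 1` curves over `ℚ` — "full BSD formula for every rank `≤ 1`
curve in class `C`" assembled STRICTLY from published theorems — so that the rank-`≤ 1` remainder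
becomes exactly the CONSTRUCTION-SHAPED classes, which are TYPED (missing-input Props), NOT attempted;
this is not "finishing BSD". This file: research-route KERNEL LEMMAS (pure algebra; no named fact, no
conjecture, nothing booked; X4 stays CONSTRUCTION-SHAPED).

## What is proved (and why)

Lemma S (surjectivity of `γ ↦ (δ_m(d_W γ))_{(W,m)}`, V52-PLAN A) is proved with TEST FUNCTIONS
`γ_{D,g}`: periodic, equal to `g(x)` at the points `x/D + ℤ` for units `x` of `ℤ/D` and `0` at every
point not of this form. This file defines them and proves exactly these three properties
(`unitPointFun`, `isPeriodic_unitPointFun`, `unitPointFun_apply_unit`, `unitPointFun_add`,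
`unitPointFun_eq_zero_of_forall`). The evaluation of the derivative family `d_W γ_{D,g}` at the points
`a/m` (brick S3) and the triangular assembly (S4–S5) are the successor's.

## References

* M. Kurihara, Contrib. Math. Comput. Sci. 7 (2014) 317–356, §1.1 (the Kurihara sums these functions
  are fed into). [cite: Kurihara2014, §1.1]
-/

noncomputable section

open scoped MatrixGroups ModularForm Classical

open CongruenceSubgroup Finset

open Literature.NumberTheory.EllipticCurves Literature.NumberTheory.EllipticCurves.ModularForms

namespace Summit.BirchSwinnertonDyer.Rank1Residual.LevelLowering

variable {R : Type*} [CommRing R]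

/-- **The test function** `γ_{D,g}`: at a rational `r`, the sum over the units `x` of `ℤ/D` of `g x` if
`r ≡ x/D (mod ℤ)` and `0` otherwise — i.e. `g(x)` on the coset `x/D + ℤ` and `0` off the points of
exact denominator `D`. [cite: Kurihara2014, §1.1] -/
def unitPointFun (D : ℕ) [NeZero D] (g : (ZMod D)ˣ → R) : ℚ → R :=
  fun r ↦ ∑ x : (ZMod D)ˣ, if ∃ z : ℤ, r = (((x : ZMod D).val : ℚ) / D) + z then g x else 0

/-- The membership condition `r ∈ x/D + ℤ` is invariant under integer translation. [folklore] -/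
private theorem exists_shift_iff (r q : ℚ) (z₀ : ℤ) :
    (∃ z : ℤ, r + z₀ = q + z) ↔ ∃ z : ℤ, r = q + z := by
  constructor
  · rintro ⟨z, hz⟩
    exact ⟨z - z₀, by push_cast; linarith⟩
  · rintro ⟨z, hz⟩
    exact ⟨z + z₀, by push_cast; linarith⟩

/-- **`γ_{D,g}` is periodic.** [folklore] -/
theorem isPeriodic_unitPointFun (D : ℕ) [NeZero D] (g : (ZMod D)ˣ → R) :
    IsPeriodic (unitPointFun D g) := by
  intro r z₀
  simp only [unitPointFun]
  refine Finset.sum_congr rfl fun x _ ↦ ?_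
  rw [exists_shift_iff]

/-- Two units of `ℤ/D` whose representatives differ by `D` times an integer are equal. [folklore] -/
private theorem units_eq_of_val_sub_div {D : ℕ} [NeZero D] {x y : (ZMod D)ˣ}
    (h : ∃ z : ℤ, (((x : ZMod D).val : ℚ) / D) = (((y : ZMod D).val : ℚ) / D) + z) : x = y := by
  have hD : 0 < D := Nat.pos_of_ne_zero (NeZero.ne D)
  obtain ⟨z, hz⟩ := h
  have hDQ : (D : ℚ) ≠ 0 := by exact_mod_cast hD.ne'
  have hx : ((x : ZMod D).val : ℚ) = ((y : ZMod D).val : ℚ) + D * z := by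
    field_simp at hz
    linarith
  have hx' : ((x : ZMod D).val : ℤ) = ((y : ZMod D).val : ℤ) + D * z := by exact_mod_cast hx
  have hxlt : (x : ZMod D).val < D := ZMod.val_lt _
  have hylt : (y : ZMod D).val < D := ZMod.val_lt _
  have hz0 : z = 0 := by
    by_contra hne
    rcases lt_or_gt_of_ne hne with hlt | hgt
    · have : (D : ℤ) * z ≤ -D := by nlinarith
      have : ((x : ZMod D).val : ℤ) < 0 := by omega
      omega
    · have : (D : ℤ) * z ≥ D := by nlinarith
      omega
  rw [hz0, mul_zero, add_zero] at hx'
  have hval : (x : ZMod D).val = (y : ZMod D).val := by exact_mod_cast hx'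
  exact Units.ext (ZMod.val_injective D hval)

/-- **Value of `γ_{D,g}` on the coset `x₀/D + ℤ`**: `γ_{D,g}(x₀/D + z) = g(x₀)` for a unit `x₀`.
[folklore] -/
theorem unitPointFun_apply_unit {D : ℕ} [NeZero D] (g : (ZMod D)ˣ → R) (x₀ : (ZMod D)ˣ) (z₀ : ℤ) :
    unitPointFun D g ((((x₀ : ZMod D).val : ℚ) / D) + z₀) = g x₀ := by
  simp only [unitPointFun]
  rw [Finset.sum_eq_single x₀]
  · rw [if_pos ⟨z₀, rfl⟩]
  · intro x _ hx
    rw [if_neg]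
    rintro ⟨z, hz⟩
    apply hx
    refine (units_eq_of_val_sub_div ⟨z - z₀, ?_⟩).symm
    push_cast
    linarith
  · intro h; exact absurd (Finset.mem_univ x₀) h

/-- **`γ_{D,g}` vanishes off the cosets `x/D + ℤ`, `x` a unit.** [folklore] -/
theorem unitPointFun_eq_zero_of_forall {D : ℕ} [NeZero D] (g : (ZMod D)ˣ → R) {r : ℚ}
    (h : ∀ (x : (ZMod D)ˣ) (z : ℤ), r ≠ (((x : ZMod D).val : ℚ) / D) + z) : unitPointFun D g r = 0 := by
  simp only [unitPointFun]
  refine Finset.sum_eq_zero fun x _ ↦ ?_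
  rw [if_neg]
  rintro ⟨z, hz⟩
  exact h x z hz

/-- **Linearity in the value function**: `γ_{D,g+g'} = γ_{D,g} + γ_{D,g'}`. [folklore] -/
theorem unitPointFun_add (D : ℕ) [NeZero D] (g g' : (ZMod D)ˣ → R) :
    unitPointFun D (fun x ↦ g x + g' x) = fun r ↦ unitPointFun D g r + unitPointFun D g' r := by
  funext r
  simp only [unitPointFun, ← Finset.sum_add_distrib]
  refine Finset.sum_congr rfl fun x _ ↦ ?_
  split_ifs <;> simp

end Summit.BirchSwinnertonDyer.Rank1Residual.LevelLowering

end
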